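import Mathlib
import HarnessLib
import HarnessLib.Audit
import Summits.Parity.Statement
import Literature.NumberTheory.Sieve.BatemanHornProofs
import HarnessLib.Audit.Status.Attr

/-!
Route: OneSidedDegreeLadder

# Route OneSidedDegreeLadder — Bateman–Horn as linear cell plus the one-sided upper and lower halves
of the non-linear cell, graded by sieve level

It suffices to show three statements whose conjunction is EXACTLY the conjunct `BatemanHorn`
(kernel: `batemanHorn_iff_pieces` in the node file): (BH_lin) LinearCell — the Bateman–Horn
asymptotic for systems all of whose members are LINEAR (the d = 1 common part of the summit; a
theorem-grade consequence of the sibling conjunct GeneralizedHardyLittlewood, tree theorem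
`Summit.Parity.BatemanHorn.Theorems.SoloBlindLinearBH.generalizedHardyLittlewood_implies_linear_batemanHorn`;
support, not staffed); (U) UpperNonlinear — for every Bateman–Horn system with at least one member
of degree ≥ 2 and every ε > 0, eventually P_f(x) ≤ (1+ε)·C(f)/(∏ deg fᵢ)·x/(log x)^k, i.e. grade θ =
1 of the one-sided UPPER ladder `P_f ≤ (θ+ε)·(BH main term)` whose grades θ = 2^k·k!·∏deg (all
systems, Selberg) and θ = 2·deg f (single f, Jurkat–Richert linear sieve at level x) are THEOREMS OF
THE TREE; (L) LowerNonlinear — the matching lower bound (1−ε)·(BH main term) ≤ P_f(x), grade θ = 1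
of the LOWER ladder, of which no grade θ > 0 is known for any non-linear system. X = LinearCell ∧
UpperNonlinear ∧ LowerNonlinear; the attacked conjunct is U, the declared (tribunal) residual is L
(and the sibling-covered BH_lin).
Lean: `LinearCell ∧ UpperNonlinear ∧ LowerNonlinear`

## Assembly
Pure logic plus two tree facts: for a system with a member of degree ≥ 2, U and L at ε = c squeeze
|P_f(x) − M_f(x)| ≤ c·M_f(x) eventually (M_f ≥ 0 because C(f) > 0,
`IsBatemanHornSystem.hasBatemanHornConst_holds`, and every member is non-constant,
`IsBatemanHornSystem.natDegree_pos`), which is `Asymptotics.isLittleO_iff`, i.e. P_f ~ M_f with the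
constant C(f) = batemanHornConst f; otherwise every member has degree exactly 1 and LinearCell
applies. The converse BH ⟹ each piece is kernel-checked in the node file (`batemanHorn_iff_pieces`),
so the split is exact and residual-free as a decomposition; at the root, Parity ⟸
GeneralizedHardyLittlewood ∧ U ∧ L (`closes_root`, `parity_iff_pieces`, modulo the landed transfer
GHL ⟹ LinearCell by name).

Rationale: WHY THIS LINE. The degree grading splits Bateman–Horn into the linear cell (covered by the other
conjunct of the summit) and the non-linear cell, and the sign grading splits the non-linear cell
into its two one-sided halves; the upper half is the top grade θ = 1 of a MONOTONE ladder
(`UpperLadder.mono`, and ⋀_{θ>1} UpperLadder θ = UpperLadder 1, `upperLadder_one_iff_forall_gt`)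
whose lower grades are exactly what upper-bound sieves prove: θ = 2^k·k!·∏deg for all systems (tree
theorem `Literature.NumberTheory.Sieve.BatemanHornSelberg.polyPrimeCount_le_selbergSieve`,
BatemanHornMathComp1962 / HalberstamRichert1974 Thm 5.3) and θ = 2·deg f for a single polynomial
(tree theorem `Literature.NumberTheory.Sieve.polyPrimeCount_single_le_linearSieve`, the linear sieve
at level of distribution x), with the printed next rungs θ < 4 for quadratics from a level x^{1+η}
(Iwaniec's bilinear remainder form, doi:10.1007/bf01578070,
[corpus:book:greavesnd-sieves-number-theory p.169]; de la Bretèche–Drappeau doi:10.4171/jems/951 =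
arXiv:1703.03197; Merikoski2022 = arXiv:1908.08816 for the Type-I/II technology on n²+1) and the
Type-I ceiling θ = 2 (level x^{deg f}: SelbergParity / Bombieri's asymptotic sieve). Imported:
one-dimensional sieve theory (Jurkat–Richert, Iwaniec) and nothing else; the lower half is priced by
two KERNEL edges of the node file (`landau_of_lowerLadder_pos`,
`bunyakovsky_nonlinear_of_lowerLadder_pos`: ANY grade θ > 0 of the lower ladder gives Landau's n²+1
problem and non-linear Bunyakovsky), so it is labelled IDEA-NEEDED + BARRIER honestly. What the line
does that prior routes and the negatives index do not: every BH-side Theses file is an EQUIV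
translation of the two-sided asymptotic (PolynomialMobius / IsogenyRedei tails, LambdaBatemanHorn)
or a Λ₂-lift whose cruxes carry Landau ∧ TwinPrime (SelbergLift; its non-eventual sieve-limit item
stmt-Parity-18416 is REFUTED), and the census row WK6 (BH_lin ∧ BH_nonlin) was judged «uninformative
without per-cell rungs» (critic C2): here the linear cell is discharged by the sibling conjunct
through a landed theorem, and the non-linear cell gets a one-sided piece with kernel-certified rungs
and a stated ceiling, in Bateman–Horn units uniform in the degree.

RANKED CRUXES. #2 UpperNonlinear (crux) — [WEAKER: BH ⟹ U kernel (`upperNonlinear_of_batemanHorn`);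
U ⟹ BH and U ⟹ L unknown (no parity-free route from an upper bound to a lower bound; U is
per-system, NOT uniform in f, so it implies none of the refuted/barriered uniform statements
UniformBatemanHorn*, and sits outside the Granville–Mollin window of
SiegelZeroQuadraticPolynomials). Leaf ATTACKABLE by a rung ladder: θ = 2^k·k!·∏deg PROVED (tree), θ
= 2·deg PROVED for single f (tree; BC5 witness), θ < 4 for irreducible quadratics (print: level
x^{1+η}), ceiling θ = 2 = Type-I limit (BARRIER SelbergParity below 2; IDEA-NEEDED: a Type-II /
bilinear input for the one-variable sequence f(n), none known
[corpus:book:harman2007-prime-detecting-sieves p.286]). The attacked conjunct of the split.] For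
every k, every Bateman–Horn system f : Fin k → ℤ[X] with some member of degree ≥ 2, and every ε > 0:
eventually in x, P_f(x) ≤ (1+ε)·C(f)/(∏ᵢ deg fᵢ)·x/(log x)^k, where P_f(x) = #{n ≤ x : every fᵢ(n)
prime} (`polyPrimeCount`) and C(f) = `batemanHornConst f`. [difficulty: open-problem] (why it might
fail: true if BH is; as a TARGET it fails where sieves stop: θ = 1 needs level of distribution
x^{deg f·(1−o(1))}·(parity-sensitive input); below θ = 2 every known upper-bound sieve is blocked by
Selberg's parity examples.) [BatemanHornMathComp1962, HalberstamRichert1974, doi:10.1007/bf01578070,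
arXiv:1703.03197, Merikoski2022, Harman2007, book:greavesnd-sieves-number-theory]
#3 LowerNonlinear (crux) — [WEAKER: BH ⟹ L kernel (`lowerNonlinear_of_batemanHorn`); L ⟹ BH, L ⟹ U
unknown (a lower bound for every non-linear system gives no upper bound: no f-uniformity to average
over, critic C2). Declared tribunal RESIDUAL of the exact split (the non-attacked conjunct). Leaf
IDEA-NEEDED + BARRIER: the lower ladder `(θ−ε)·main ≤ P_f` is a theorem only for θ ≤ 0
(`lowerLadder_of_nonpos`), and ANY θ > 0 already yields Landau's n²+1 problem and non-linear
Bunyakovsky (kernel edges `landau_of_lowerLadder_pos`, `bunyakovsky_nonlinear_of_lowerLadder_pos`);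
SelbergParity / FordMaynardPrimeSieves / WeightedSieveLimit forbid a sieve-theoretic lower bound;
parity has been broken only for two-variable thin sequences x²+y⁴ (FriedlanderIwaniec1998), x³+2y³
(HeathBrownActa2001). INSTRUMENTABLE proxies: Iwaniec's P₂ for n²+1, Merikoski's largest prime
factor of n²+1 ≥ n^{1.279}, Bateman–Horn on average over polynomial families; census ask = certified
P_f(x)/M_f(x) tables for X²+1, X²+X+1, X³+2, (X, X²+1), x = 10^6 … 10^9.] For every k, every
Bateman–Horn system f with some member of degree ≥ 2, and every ε > 0: eventually in x,
(1−ε)·C(f)/(∏ᵢ deg fᵢ)·x/(log x)^k ≤ P_f(x). [difficulty: open-problem] (why it might fail: true if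
BH is; as a target it contains Landau's problem (not one prime value of a non-linear polynomial is
known infinitely often): every sieve lower bound is killed by parity (Selberg, Bombieri,
Ford–Maynard).) [BatemanHornMathComp1962, FriedlanderIwaniecOpera2010, FriedlanderIwaniec1998,
HeathBrownActa2001, Merikoski2022, LemkeOliver2012]
#9 LinearCell (support) — [WEAKER: BH ⟹ it (`linearCell_of_batemanHorn`); COVERED-BY-SIBLING:
GeneralizedHardyLittlewood ⟹ LinearCell is the landed tree theorem
`Summit.Parity.BatemanHorn.Theorems.SoloBlindLinearBH.generalizedHardyLittlewood_implies_linear_batemanHorn`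
(statement verbatim); not staffed; leaf = the d = 1 content of the other conjunct (rungs
BoundedDickson stmt-Parity-13151, TwinLowerDensity stmt-Parity-18377; BARRIER PrimePairParity).
Tribunal residual (imported complement).] The Bateman–Horn asymptotic for every Bateman–Horn system
all of whose members have degree 1 (Dickson systems with no fixed prime divisor). [difficulty:
open-problem] [BatemanHornMathComp1962, GreenTao2010]

TWO-LAYER PLAN. U ⇐ UpperTwo → TwoToOne → U, foreseen: UpperTwo = `UpperLadder 2` (P_f ≤ (2+ε)·main
for every non-linear system: the Type-I ceiling, itself a ladder Selberg 2^k·k!·∏deg → 2·deg (single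
f, PROVED) → <4 (quadratics, print) → 2), TwoToOne = `UpperLadder 2 → UpperNonlinear` (the
parity-sensitive step, isolated). L ⇐ LowerPos → PosToOne → L with LowerPos = `∃ θ > 0, LowerLadder
θ` (already Landau-hard: the honest first rung) — filed only if an idea for a positive lower grade
appears. Nothing filed now.

KILL CRITERIA. U and L are kernel consequences of BatemanHorn (`upperNonlinear_of_batemanHorn`,
`lowerNonlinear_of_batemanHorn`), so a refutation of either REFUTES THE CONJUNCT BatemanHorn itself
(close --reason refuted:<Decl> and file the witness system as a summit negative); a refutation of
LinearCell refutes both conjuncts (it is implied by GHL too). The route is mooted (superseded) if a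
two-sided BH route closes the non-linear cell directly; it pivots to the Two-layer plan's UpperTwo
node if a refuter shows U as typed is summit-strength in print (an upper-to-lower transfer for
polynomial prime values — none known). A tribunal finding that U ⟹ BH cheaply would retire the split
(not expected: the BC2 probe fails).

NOT DECOMPOSED YET. The rung ladder under U (θ = 2·deg for SYSTEMS rather than single polynomials; θ
< 4 for quadratics via a vendored Iwaniec / de la Bretèche–Drappeau level-of-distribution fact; the
Type-I ceiling θ = 2) is layer-2 (Two-layer plan) and rung routes, not items: rungs are theorems
short of U and earn no summit credit. The Siegel-zero sub-split of U along the Granville–Mollin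
family (uniformity in f) is deliberately NOT made: U is per-system. The instrument table for L
(certified P_f/M_f ratios) is a census ask, not an item.

CHEAPEST FALSIFIER. Lookup: is there ANY theorem or preprint deriving a two-sided polynomial
prime-value asymptotic (or a lower bound) from a one-sided upper bound of Bateman–Horn strength, or
proving P_f(x) ≤ (1+ε)·M_f(x) for a single non-linear f? Ran: `lit search --hybrid "upper bound
primes represented by polynomial Bateman-Horn constant sieve"`, `lit search "niveau de répartition
polynômes quadratiques crible majorant"`, `lit galaxy search "primes of the form n^2+1|Almost-primes
represented by quadratic polynomials" --star all` — best constants in print stay at θ ≥ 2·(level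
exponent)⁻¹·deg > 1 (Iwaniec 1978; Lemke Oliver 2012 [corpus:paper:doi-10-4064-aa151-3-2 p.2]; de la
Bretèche–Drappeau 2020); no upper⟹lower transfer found. In-Lean: the BC2 probes `UpperNonlinear →
BatemanHorn`, `LowerNonlinear → BatemanHorn` by exact?/simpa/aesop FAIL (bc/ folder).

NUMBERS. Upper ladder grades in BH units (P_f ≤ (θ+ε)·C(f)/∏deg·x/log^k x): θ = 2^k·k!·∏deg fᵢ, all
systems — PROVED (tree, `polyPrimeCount_le_selbergSieve`); θ = 2·deg f, single polynomial — PROVED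
(tree, `polyPrimeCount_single_le_linearSieve`, level of distribution x); θ = 2·deg/(1+η) for
irreducible quadratics from level x^{1+η} (Iwaniec 1978 doi:10.1007/bf01578070; de la
Bretèche–Drappeau arXiv:1703.03197) — print, exact η not vendored; Type-I ceiling θ = 2 (level
x^{deg f(1−o(1))}); target θ = 1. Lower ladder: θ ≤ 0 PROVED (trivial), every θ > 0 open and ⟹
LandauConjecture (kernel). Proxies: n²+1 = P₂ infinitely often (Iwaniec 1978); largest prime factor
of n²+1 exceeds n^{1.279} infinitely often (Merikoski2022).

DEFINITION REQUESTS. None: `polyPrimeCount`, `batemanHornConst`, `IsBatemanHornSystem`,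
`BatemanHornAsymptotic` exist (Literature.NumberTheory.Sieve.BatemanHorn). Cite fact wanted later
for the quadratic rung: Iwaniec 1978 / de la Bretèche–Drappeau 2020 level of distribution x^{1+η}
for irreducible quadratic n ↦ f(n) (not filed by this seat).

Novelty: Searches (2026-08-30): `lit search --hybrid "Iwaniec almost-primes quadratic polynomials upper bound
sieve constant"` (held: arxiv-1908.08816, doi-10-4064-aa151-3-2, greavesnd, harman2007); `lit search
"niveau de répartition polynômes quadratiques crible majorant" --source all` (doi:10.4171/jems/951 =
arXiv:1703.03197 + 5 corpus citers); `lit search "Iwaniec almost-primes represented by quadratic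
polynomials" --source all` (zbmath+crossref doi:10.1007/bf01578070, LemkeOliver2012,
arXiv:1910.02885); `lit galaxy search "primes of the form n^2+1|Almost-primes represented by
quadratic polynomials" --star all` (panama: Greaves, Ribenboim, Guy; pdf 2 unrelated); `rg` over
Summits/Parity/BatemanHorn/Theses (31 files: no one-sided / halves node; SelbergLift is a Λ₂-lift
with two-sided cruxes) and the cell census COSTUME-CENSUS-v1 rows WK6 (BH_lin ∧ BH_nonlin) / T7
(halves); `ledger negatives --problem Parity` (5; nearest stmt-Parity-18416 SelbergLiftSelbergSplit,
a non-eventual ∀ε∀x sieve bound — different statement, refuted for that reason).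
Nearest prior art found: tree theorem
`Summit.Parity.BatemanHorn.Theorems.SoloBlindLinearBH.parity_iff` (Parity ⟺ GHL ∧ non-linear BH: the
degree split without halves or rungs); route SelbergLift (Λ₂-upper-bound lift, cruxes
costume-strength); writer frame GA OneSidedHalves on the GHL side (sign axis for prime PAIRS); in
print the one-sided upper bounds themselves (BatemanHornMathComp1962 §3, HalberstamRichert1974 Thm
5.3, Iwaniec 1978, LemkeOli  [refs: 10.4171/jems/951, 10.1007/bf01578070, 1703.03197, 1910.02885, arxiv-1908.08816, doi-10-4064-aa151-3-2, doi:10.4171/jems/951, doi:10.1007/bf01578070, LemkeOliver2012, BatemanHornMathComp1962, HalberstamRichert1974]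

Barriers (technique_class: upper-bound-sieve, level-of-distribution, degree-grading): - technique_class: upper-bound-sieve, level-of-distribution, degree-grading
- Literature.Barriers.Parity.SelbergParityBarrier: it does not evade it for the TOP grades — U below
θ = 2 and every positive grade of L are inside the parity-blocked class for Type-I sieves (no
positive lower bound, no upper constant below twice the expectation); the bet is confined to the
rungs θ ≥ 2 (one-sided upper bounds are exactly what Selberg's examples permit) and the pieces are
labelled BARRIER/IDEA-NEEDED below that; `closes` itself is pure logic, not a sieve deduction.
- Literature.Barriers.Parity.FordMaynardLowLevel: same placement — the values of one polynomial of
degree ≥ 2 are a thin set (x^{1/deg} of the integers up to x^deg) with Type-I level < 1/2 of the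
size and no Type-II range, so no lower bound (L, or U below 2) comes from Type-I/II sums; rungs θ ≥
2 are upper bounds, which the barrier explicitly leaves open ("one can still obtain strong upper
bounds").
- Literature.Barriers.Parity.FordMaynardMinimalTypeII: the minimal Type-II range needed for prime
detection is unavailable for one-variable polynomial sequences; this is WHY the leaf under θ = 2 is
tagged IDEA-NEEDED (a Type-II input for f(n)), not an evasion.
- Literature.Barriers.Parity.FordFixedLevelBarrier: an exact asymptotic (θ = 1 on both sides) cannot
be deduced from any fixed level of distribution; the route does not claim such a deduction — the
ladder's rungs are upper bounds at increasing level, and the step 2 → 1 is i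

History (route lifecycle, newest last):
- 2026-08-30T12:08:50Z · rev 3: informal re-worded for stmt-Parity-32819 (planner-decomp-parity-lens-1-g8-0)
- 2026-08-30T12:20:26Z · rev 3: informal re-worded for stmt-Parity-32819 (planner-decomp-parity-lens-1-g8-0)
- 2026-08-30T12:33:25Z · rev 3: informal re-worded for stmt-Parity-32819 (planner-decomp-parity-lens-1-g8-0)
- 2026-08-30T12:33:58Z · rev 3: informal re-worded for stmt-Parity-32819 (planner-decomp-parity-lens-1-g8-0)
- 2026-08-30T12:34:31Z · rev 3: informal re-worded for stmt-Parity-32819 (planner-decomp-parity-lens-1-g8-0)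
- 2026-08-30T12:35:02Z · rev 3: informal re-worded for stmt-Parity-32819 (planner-decomp-parity-lens-1-g8-0)
- 2026-08-30T12:59:14Z · rev 3: informal re-worded for stmt-Parity-32819 (planner-decomp-parity-lens-1-g8-0)
- 2026-08-30T13:03:45Z · rev 3: informal re-worded for stmt-Parity-32819 (planner-decomp-parity-lens-1-g8-0)

sub-problem: BatemanHorn · status: open · opened planner-decomp-parity-lens-1-g0-0 2026-08-30T02:24:47Z · rev 4 · ledger route-Parity-OneSidedDegreeLadder
GENERATED by the gate from the ledger (D-0016/17). Provers cite these decls: `theorem foo : Summit.Parity.BatemanHorn.Theses.OneSidedDegreeLadder.<Decl> := …` in Summits/Parity/BatemanHorn/Theorems/<Name>.lean.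
-/

namespace Summit.Parity.BatemanHorn.Theses.OneSidedDegreeLadder

open scoped BigOperators Topology Manifold Classical MeasureTheory ProbabilityTheory Matrix InnerProductSpace ComplexConjugate ContinuousMap
open Filter Set Function TopologicalSpace MeasureTheory

attribute [summit_statement] _root_.BatemanHorn

/-- item stmt-Parity-25176 · crux · rank 2 · SPLIT (gen 1) into UpperQuadThree, UpperLevelLift, UpperParityLift + glue UpperNonlinearGlue · direct attempts still welcome (low priority) · by planner
why it might fail: true if BH is; as a TARGET it fails where sieves stop: θ = 1 needs level of distribution x^{deg f·(1−o(1))}·(parity-sensitive input); below θ = 2 every known upper-bound sieve is blocked by Selberg's parity examples.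
sources: BatemanHornMathComp1962, HalberstamRichert1974, doi:10.1007/bf01578070, arXiv:1703.03197, Merikoski2022, Harman2007
[crux] [WEAKER: BH ⟹ U kernel (`upperNonlinear_of_batemanHorn`); U ⟹ BH and U ⟹ L unknown (no
parity-free route from an upper bound to a lower bound; U is per-system, NOT uniform in f, so it
implies none of the refuted/barriered uniform statements UniformBatemanHorn*, and sits outside the
Granville–Mollin window of SiegelZeroQuadraticPolynomials). Leaf ATTACKABLE by a rung ladder: θ =
2^k·k!·∏deg PROVED (tree), θ = 2·deg PROVED for single f (tree; BC5 witness), θ < 4 for irreducible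
quadratics (print: level x^{1+η}), ceiling θ = 2 = Type-I limit (BARRIER SelbergParity below 2;
IDEA-NEEDED: a Type-II / bilinear input for the one-variable sequence f(n), none known
[corpus:book:harman2007-prime-detecting-sieves p.286]). The attacked conjunct of the split.] For
every k, every Bateman–Horn system f : Fin k → ℤ[X] with some member of degree ≥ 2, and every ε > 0:
eventually in x, P_f(x) ≤ (1+ε)·C(f)/(∏ᵢ deg fᵢ)·x/(log x)^k, where P_f(x) = #{n ≤ x : every fᵢ(n)
prime} (`polyPrimeCount`) and C(f) = `batemanHornConst f`. [difficulty: open-problem] -/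
@[route_item "route-Parity-OneSidedDegreeLadder", crux]
def UpperNonlinear : Prop :=
  ∀ (k : ℕ) (f : Fin k → Polynomial ℤ), Literature.NumberTheory.Sieve.IsBatemanHornSystem f → (∃ i, 2 ≤ (f i).natDegree) → ∀ ε : ℝ, 0 < ε → ∀ᶠ x : ℕ in atTop, (Literature.NumberTheory.Sieve.polyPrimeCount f x : ℝ) ≤ (1 + ε) * (Literature.NumberTheory.Sieve.batemanHornConst f / (∏ i, ((f i).natDegree : ℝ)) * (x : ℝ) / Real.log x ^ k)

-- parent: UpperNonlinear · child (gen 1)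
/--     item stmt-Parity-31723 · crux · rank 201 · open
    parent: UpperNonlinear · by planner
    why it might fail: As a theorem target it asks for level x^{4/3} for quadratic root-congruence sums; print reaches only x^{1+γ}, γ < 1/3 (Iwaniec/Lemke Oliver/de la Bretèche–Drappeau, spectral methods capped by Selberg-eigenvalue-type losses); the statement itself is implied by Bateman–Horn.
    sources: LemkeOliver2012, doi:10.4064/aa151-3-2, doi:10.1007/BF01578070, doi:10.4171/jems/951, arXiv:1703.03197, Merikoski2022
[crux; node UpperLevelLadder (lens-1 g6), the QUADRATIC UPPER CELL at the FIXED grade notch θ₀ = 3;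
credit in LEVEL/θ-currency ONLY (LADDER-Parity rung 0); no prover seat beyond the hands named on the
bus] For every irreducible quadratic q forming a Bateman–Horn system (IsBatemanHornSystem ![q]:
positive leading coefficient, no fixed prime divisor) and every ε > 0: eventually P_q(x) ≤
(3+ε)·C(q)/2·x/log x, i.e. at most THREE times the Bateman–Horn prediction. NECESSARY: BatemanHorn ⟹
UpperNonlinear ⟹ UpperQuadThree (kernel upperQuadThree_of_upperNonlinear, pieces_of_batemanHorn; the
quadratic dial UpperQuadAt θ is necessary at every θ ≥ 1, upperQuadAt_of_upperNonlinear). WEAKER: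
one cell at grade 3 versus every non-linear system at grade 1; no converse known or claimed.
DICTIONARY grade ↔ level (dimension one, linear sieve F(s) = 2e^γ/s, z² = D): a
well-factorable/bilinear level of distribution x^ϑ for the root-congruence counts of q gives exactly
θ = 4/ϑ, and by LinearSieveOptimality (ii) (tree, proved) nothing better from the sieve axioms at
that level — so inside the sieve class this item IS the level statement ϑ = 4/3. PRINTED LADDER: θ =
4 (ϑ = 1) is a THEOREM (tree polyPrimeC -/
@[route_item "route-Parity-OneSidedDegreeLadder"]
def UpperQuadThree : Prop :=
  ∀ q : Polynomial ℤ, Literature.NumberTheory.Sieve.IsBatemanHornSystem ![q] → q.natDegree = 2 → ∀ ε : ℝ, 0 < ε → ∀ᶠ x : ℕ in Filter.atTop, (Literature.NumberTheory.Sieve.polyPrimeCount ![q] x : ℝ) ≤ (3 + ε) * (Literature.NumberTheory.Sieve.batemanHornConst ![q] / 2 * (x : ℝ) / Real.log x)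

-- parent: UpperNonlinear · child (gen 1)
/--     item stmt-Parity-31724 · crux · rank 202 · open
    parent: UpperNonlinear · by planner
    why it might fail: True if Bateman–Horn is; as a target it is Elliott–Halberstam-strength level x^{deg−o(1)} for every polynomial sequence (no degree ≥ 3 polynomial has any printed level beyond x; none gives level 2 even for n²+1), and for k ≥ 2 systems grade 2 is uncharted, possibly parity-loaded.
    sources: LemkeOliver2012, doi:10.4064/aa151-3-2, Greaves2001, HalberstamRichert1974, BombieriAsymptoticSieve1976, Literature.NumberTheory.Sieve.ParityBarrier
[crux; node UpperLevelLadder (lens-1 g6), the LEVEL LIFT to the Type-I ceiling; IDEA-NEEDED(level,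
Elliott–Halberstam strength) and parity-FREE in the ONE-POLYNOMIAL dictionary (sieve dimension κ =
1: k = 1 cells, Bombieri's Type-I bound δ ≤ 2); for k ≥ 2 non-linear SYSTEMS (dimension k, tree rung
2^k·k!·∏deg) grade 2 is UNCHARTED — neither «ceiling 2» nor parity-freeness is in print there
(Bombieri/Ford indeterminacy widens with κ), possibly barrier-loaded (critic row 69 P3: the census
must not book this item as parity-free beyond k = 1); zero rung credit toward Bateman–Horn either
way; NO prover seat] For every k, every Bateman–Horn system f with some member of degree ≥ 2, and
every ε > 0: eventually P_f(x) ≤ (2+ε)·C(f)/(∏ deg fᵢ)·x/(log x)^k (grade 2) — GIVEN, when the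
system is a single quadratic (k = 1 ∧ deg = 2), grade 3 for that system (so the sibling
UpperQuadThree is consumed here and nowhere else; on every other cell the demand is grade 2
outright, kernel upperLevelLift_nonquad; on the quadratic cell it is the descent 3 → 2, kernel
upperLevelLift_quad). NECESSITY: UpperNonlinear ⟹ UpperLadder 2 ⟹ UpperLevelLift (kernel
upperLevelLift_of_upperNonlinear). WEAKER: implied by -/
@[route_item "route-Parity-OneSidedDegreeLadder"]
def UpperLevelLift : Prop :=
  ∀ (k : ℕ) (f : Fin k → Polynomial ℤ), Literature.NumberTheory.Sieve.IsBatemanHornSystem f → (∃ i, 2 ≤ (f i).natDegree) → ((k = 1 ∧ ∀ i, (f i).natDegree = 2) → ∀ ε : ℝ, 0 < ε → ∀ᶠ x : ℕ in Filter.atTop, (Literature.NumberTheory.Sieve.polyPrimeCount f x : ℝ) ≤ (3 + ε) * (Literature.NumberTheory.Sieve.batemanHornConst f / (∏ i, ((f i).natDegree : ℝ)) * (x : ℝ) / Real.log x ^ k)) → ∀ ε : ℝ, 0 < ε → ∀ᶠ x : ℕ in Filter.atTop, (Literature.NumberTheory.Sieve.polyPrimeCount f x : ℝ) ≤ (2 +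 ε) * (Literature.NumberTheory.Sieve.batemanHornConst f / (∏ i, ((f i).natDegree : ℝ)) * (x : ℝ) / Real.log x ^ k)

-- parent: UpperNonlinear · child (gen 1)
/--     item stmt-Parity-31725 · crux · rank 203 · open
    parent: UpperNonlinear · by planner
    why it might fail: True if Bateman–Horn is; as a target it is parity-breaking for one-variable polynomial sequences (below Bombieri's δ = 2), for which no Type-II information is known — exactly the content SelbergParityBarrier / bombieri_asymptotic_sieve_indeterminacy certify as invisible to Type-I data.
    sources: BombieriAsymptoticSieve1976, FriedlanderIwaniecOpera2010, FordMaynardPrimeSieves, Harman2007, Literature.Barriers.Parity.SelbergParityBarrier, Literature.Barriers.Parity.LinearSieveOptimality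
[crux; node UpperLevelLadder (lens-1 g6); DECLARED RESIDUAL of the split of UpperNonlinear — the
PARITY content of the non-linear upper half; BARRIER head-on (SelbergParity, Bombieri's
asymptotic-sieve indeterminacy δ ∈ [0,2], LinearSieveOptimality (ii) «beating the constant 2»,
FordMaynardMinimalTypeII); TERMINAL notch; ZERO credit; never staffed] For every k, every
Bateman–Horn system f with some member of degree ≥ 2: IF eventually P_f(x) ≤ (2+ε)·M_f(x) for every
ε > 0 (grade 2, the Type-I ceiling) THEN eventually P_f(x) ≤ (1+ε)·M_f(x) for every ε > 0 (grade 1 =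
UpperNonlinear's own conclusion) — the parent's text plus ONE hypothesis per system (critic T13 (iv)
shape, as OddSignLift 30154). NECESSARY (kernel upperParityLift_of_upperNonlinear) and WEAKER as
typed; HONEST READING: the day grade 2 (UpperQuadThree ∧ UpperLevelLift) lands, this item IS the
parent (kernel upperParityLift_iff_parent : UpperLadder 2 → (UpperParityLift ↔ UpperNonlinear)).
Tree model of the cut: Type-I data of full level reach exactly δ = 2 (prime_mass_le_two_holds) and
every δ ∈ [0,2] occurs (bombieri_asymptotic_sieve_indeterminacy_holds), so this step is invisible to
Type-I information of any level; any -/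
@[route_item "route-Parity-OneSidedDegreeLadder"]
def UpperParityLift : Prop :=
  ∀ (k : ℕ) (f : Fin k → Polynomial ℤ), Literature.NumberTheory.Sieve.IsBatemanHornSystem f → (∃ i, 2 ≤ (f i).natDegree) → (∀ ε : ℝ, 0 < ε → ∀ᶠ x : ℕ in Filter.atTop, (Literature.NumberTheory.Sieve.polyPrimeCount f x : ℝ) ≤ (2 + ε) * (Literature.NumberTheory.Sieve.batemanHornConst f / (∏ i, ((f i).natDegree : ℝ)) * (x : ℝ) / Real.log x ^ k)) → ∀ ε : ℝ, 0 < ε → ∀ᶠ x : ℕ in Filter.atTop, (Literature.NumberTheory.Sieve.polyPrimeCount f x : ℝ) ≤ (1 + ε) * (Literature.NumberTheory.Sieve.batemanHornConst f / (∏ i, ((f i).natDegree : ℝ)) * (x : ℝ) / Real.log x ^ k)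

-- parent: UpperNonlinear · glue (gen 1)
/--     item stmt-Parity-31726 · support · rank 204 · closed · proved by Summit.Parity.BatemanHorn.Theses.OneSidedDegreeLadder.upperNonlinearGlue_holds (prover)
    parent: UpperNonlinear · GLUE: children ⟹ parent · by planner
UpperQuadThree → UpperLevelLift → UpperParityLift → UpperNonlinear: kernel-checked as
upperNonlinear_of_pieces / upperNonlinearGlue_holds in
HOME/decomp-parity-lens-1/g6/UpperLevelLadder.lean @2a51ffc02d620f33 (rc0, 0 sorry, std axioms): on
a single-quadratic system UpperLevelLift consumes the grade-3 notch UpperQuadThree (one-member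
transport LowerNonlinearGlue.vec_single_eq/mainTerm_single, already landed) and yields grade 2, on
every other non-linear system grade 2 outright; UpperParityLift lifts grade 2 to grade 1 =
UpperNonlinear system by system. Ready-to-land hand file
HOME/decomp-parity-lens-1/g6/file/hand/OneSidedDegreeLadderUpperNonlinearGlue.lean (glue item = node
construction; hands allowed). -/
@[route_item "route-Parity-OneSidedDegreeLadder"]
def UpperNonlinearGlue : Prop :=
  UpperQuadThree → UpperLevelLift → UpperParityLift → UpperNonlinear

-- `UpperNonlinearGlue` holds: proved by `Summit.Parity.BatemanHorn.Theses.OneSidedDegreeLadder.upperNonlinearGlue_holds` (its module imports this route file, so no `_holds` link can be stated here).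

/-- item stmt-Parity-25177 · crux · rank 3 · SPLIT (gen 1) into ChenQuad, ChenRest, ParityLift + glue LowerNonlinearGlue · direct attempts still welcome (low priority) · by planner
why it might fail: true if BH is; as a target it contains Landau's problem (not one prime value of a non-linear polynomial is known infinitely often): every sieve lower bound is killed by parity (Selberg, Bombieri, Ford–Maynard).
sources: BatemanHornMathComp1962, FriedlanderIwaniecOpera2010, FriedlanderIwaniec1998, HeathBrownActa2001, Merikoski2022, LemkeOliver2012
[crux] [WEAKER: BH ⟹ L kernel (`lowerNonlinear_of_batemanHorn`); L ⟹ BH, L ⟹ U unknown (a lower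
bound for every non-linear system gives no upper bound: no f-uniformity to average over, critic C2).
Declared tribunal RESIDUAL of the exact split (the non-attacked conjunct). Leaf IDEA-NEEDED +
BARRIER: the lower ladder `(θ−ε)·main ≤ P_f` is a theorem only for θ ≤ 0 (`lowerLadder_of_nonpos`),
and ANY θ > 0 already yields Landau's n²+1 problem and non-linear Bunyakovsky (kernel edges
`landau_of_lowerLadder_pos`, `bunyakovsky_nonlinear_of_lowerLadder_pos`); SelbergParity /
FordMaynardPrimeSieves / WeightedSieveLimit forbid a sieve-theoretic lower bound; parity has been
broken only for two-variable thin sequences x²+y⁴ (FriedlanderIwaniec1998), x³+2y³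
(HeathBrownActa2001). INSTRUMENTABLE proxies: Iwaniec's P₂ for n²+1, Merikoski's largest prime
factor of n²+1 ≥ n^{1.279}, Bateman–Horn on average over polynomial families; census ask = certified
P_f(x)/M_f(x) tables for X²+1, X²+X+1, X³+2, (X, X²+1), x = 10^6 … 10^9.] For every k, every
Bateman–Horn system f with some member of degree ≥ 2, and every ε > 0: eventually in x,
(1−ε)·C(f)/(∏ᵢ deg fᵢ)·x/(log x)^k ≤ P_f(x). [difficulty: open-proble -/
@[route_item "route-Parity-OneSidedDegreeLadder", crux (bottleneck := work) (experiment := "instrument: formUpperGivenFixed INSTRUMENTABLE, FixedLower BARRIER); BH side B1 = route-Parity-OneSidedDegreeLadder (OPEN rev 4 692ce33e9602; 8 open le…") (source := "director PARITY l.15, 2026-09-01")]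
def LowerNonlinear : Prop :=
  ∀ (k : ℕ) (f : Fin k → Polynomial ℤ), Literature.NumberTheory.Sieve.IsBatemanHornSystem f → (∃ i, 2 ≤ (f i).natDegree) → ∀ ε : ℝ, 0 < ε → ∀ᶠ x : ℕ in atTop, (1 - ε) * (Literature.NumberTheory.Sieve.batemanHornConst f / (∏ i, ((f i).natDegree : ℝ)) * (x : ℝ) / Real.log x ^ k) ≤ (Literature.NumberTheory.Sieve.polyPrimeCount f x : ℝ)

-- parent: LowerNonlinear · child (gen 1)
/--     item stmt-Parity-26565 · crux · rank 301 · open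
    parent: LowerNonlinear · by planner
    why it might fail: θ = 1 for P₂ may need level ≈ x^{1.68} for n²+1 in APs (unweighted; less with weights) vs the known x^{1.279} (Merikoski 2023); LinearSieveOptimality + WeightedSieveLimit cap what weights recover at fixed level; the missing level may be as hard as any quadratic-congruence equidistribution problem.
    sources: Iwaniec1978, greavesnd-sieves-number-theory p.141 (2.11), p.143 Cor. 5.1.4, doi:10.4064/aa151-3-2, Literature.Barriers.Parity.LinearSieveOptimality, Literature.Barriers.Parity.WeightedSieveLimit
[crux, rank 2; node AlmostPrimeExcessLadder, grade (θ,e)=(1,1) on the quadratic cell] For every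
irreducible quadratic q forming a Bateman–Horn system, #{n ≤ x : q(n) > 1, Ω(q(n)) ≤ 2} ≥
(1−ε)·C(q)/2·x/log x eventually — Chen/Iwaniec's P₂ theorem for n²+1 WITH THE BATEMAN–HORN CONSTANT.
WEAKER than LowerNonlinear (kernel: counts a superset; converse = Landau). Leaf ATTACKABLE-rungs +
INSTRUMENTABLE: proved rungs (1/77,1) Iwaniec 1978 (tree fact Iwaniec1978.card_P2_lower) and (1,2)
Richert–Greaves; instrument = the P₂ constant θ₂(ϑ) as a function of the (well-factorable) level x^ϑ
of q(n) in APs; the UNWEIGHTED rough detector θ₂(ϑ) = 6·log(1.5ϑ−1)/(1.5ϑ) is ≤ 0 for ϑ ≤ 4/3 and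
reaches 1 only at ϑ* ≈ 1.68, while the known levels for n²+1 are 16/15 (Iwaniec) → 1.218 (de la
Bretèche–Drappeau 2020) → 1.279 (Merikoski 2023) < 4/3 — so EVERY live rung (incl. 1/77) is a
WEIGHTED-sieve rung (Richert/Iwaniec/Greaves/DHG weights), and the obstruction at the record is
LinearSieveOptimality f(s) + WeightedSieveLimit Λ_R ≤ R at level 1.279. Not parity-blocked (e = 1 is
Type-I-accessible in Bombieri's asymptotic-sieve model, tree theorem
bombieri_asymptotic_sieve_holds). -/
@[route_item "route-Parity-OneSidedDegreeLadder"]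
def ChenQuad : Prop :=
  ∀ q : Polynomial ℤ, Literature.NumberTheory.Sieve.IsBatemanHornSystem ![q] → q.natDegree = 2 → ∀ ε : ℝ, 0 < ε → ∀ᶠ x : ℕ in Filter.atTop, (1 - ε) * (Literature.NumberTheory.Sieve.batemanHornConst ![q] / 2 * (x : ℝ) / Real.log x) ≤ (((Finset.range (x + 1)).filter fun n : ℕ => 1 < q.eval (n : ℤ) ∧ ArithmeticFunction.cardFactors ((q.eval (n : ℤ)).toNat) ≤ 2).card : ℝ)

-- parent: LowerNonlinear · child (gen 1)
/--     item stmt-Parity-26566 · crux · rank 302 · open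
    parent: LowerNonlinear · by planner
    why it might fail: Already e = g−1 (P_g values of one degree-g polynomial) is open for every g ≥ 3: WeightedSieveLimit (Λ_R ≤ R) bars weights at level 1 and no level > 1 is known for degree ≥ 3 congruences (Lemke Oliver 2012); e = 1 for k ≥ 2 systems is far beyond DHG Ch. 11.
    sources: greavesnd-sieves-number-theory p.143 Cor. 5.1.4, book-halberstamnd-higher-dimensional-sieve-method p.104-110, doi:10.4064/aa151-3-2, Literature.Barriers.Parity.WeightedSieveLimit, Literature.NumberTheory.Sieve.BatemanHornAlmostPrimes.batemanHorn_almostPrimes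
[crux, rank 3; node AlmostPrimeExcessLadder, grade (1,1) on every nonlinear cell other than {one
quadratic}] For every Bateman–Horn system with a member of degree ≥ 2, not a single quadratic, #{n ≤
x : all f_i(n) > 1, Σ_i Ω(f_i(n)) ≤ k+1} ≥ (1−ε)·C(f)/∏deg f_i·x/(log x)^k eventually. WEAKER than
LowerNonlinear (kernel). Leaf IDEA-NEEDED(level) with a priced inner ladder: single f of degree g ≥
3 has e = g PROVED at θ ≈ 0.76g (Greaves Cor. 5.1.4), e ≤ g−1 open (needs level > 1 for degree-g
congruences); k ≥ 2: some (θ,e) proved in kernel from the tree's batemanHorn_almostPrimes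
(fundamental lemma). -/
@[route_item "route-Parity-OneSidedDegreeLadder"]
def ChenRest : Prop :=
  ∀ (k : ℕ) (f : Fin k → Polynomial ℤ), Literature.NumberTheory.Sieve.IsBatemanHornSystem f → (∃ i, 2 ≤ (f i).natDegree) → ¬ (k = 1 ∧ ∀ i, (f i).natDegree = 2) → ∀ ε : ℝ, 0 < ε → ∀ᶠ x : ℕ in Filter.atTop, (1 - ε) * (Literature.NumberTheory.Sieve.batemanHornConst f / (∏ i, ((f i).natDegree : ℝ)) * (x : ℝ) / Real.log x ^ k) ≤ (((Finset.range (x + 1)).filter fun n : ℕ => (∀ i, 1 < (f i).eval (n : ℤ)) ∧ ∑ i, ArithmeticFunction.cardFactors (((f i).eval (n : ℤ)).toNat) ≤ k + 1).card : ℝ)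

-- parent: LowerNonlinear · child (gen 1)
/--     item stmt-Parity-26567 · crux · rank 303 · open
    parent: LowerNonlinear · by planner
    why it might fail: It must beat the parity barrier head-on: SelbergParityBarrier, FordMaynard MinimalTypeII/LowLevel and WeightedSieveLimit at R = 1 — no sieve of any level turns a P₂ lower bound into a prime one; Bombieri's asymptotic sieve leaves the prime mass δ ∈ [0,2] free in the same axiom class.
    sources: Literature.Barriers.Parity.SelbergParityBarrier, Literature.Barriers.Parity.FordMaynardPrimeSieves, Literature.Barriers.Parity.WeightedSieveLimit, book-friedlandernd-analytic-number-theory p.19-21, Literature.NumberTheory.Sieve.bombieri_asymptotic_sieve_indeterminacy_holds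
[crux, rank 4 · DECLARED-RESIDUAL · TERMINAL notch · ZERO rung credit · BARRIER head-on; node
AlmostPrimeExcessLadder, the step (1,1) ⟹ (1,0) cell-wise] For every nonlinear Bateman–Horn system:
IF the excess-1 almost-prime count has the full-constant lower bound, THEN so does the prime count
polyPrimeCount. This is exactly the parity content of LowerNonlinear, isolated from its level
content (ChenQuad, ChenRest); formally WEAKER (kernel L → ParityLift; vacuous off the content
branch), terminal notch (no contraction when the other pieces land). Model separation e ≥ 1 vs e =
0: tree theorems bombieri_asymptotic_sieve_holds / bombieri_asymptotic_sieve_indeterminacy_holds.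
Not staffed as attackable; any parity-breaking input (bilinear/Type-II information for q(n), λ along
polynomial values) would enter here. Shelf-life declared (critic T11(b)/T8): the day ChenQuad ∧
ChenRest land, this item is «theorem ∧ L» and the node retires — no successor notch. -/
@[route_item "route-Parity-OneSidedDegreeLadder"]
def ParityLift : Prop :=
  ∀ (k : ℕ) (f : Fin k → Polynomial ℤ), Literature.NumberTheory.Sieve.IsBatemanHornSystem f → (∃ i, 2 ≤ (f i).natDegree) → (∀ ε : ℝ, 0 < ε → ∀ᶠ x : ℕ in Filter.atTop, (1 - ε) * (Literature.NumberTheory.Sieve.batemanHornConst f / (∏ i, ((f i).natDegree : ℝ)) * (x : ℝ) / Real.log x ^ k) ≤ (((Finset.range (x + 1)).filter fun n : ℕ => (∀ i, 1 < (f i).eval (n : ℤ)) ∧ ∑ i, ArithmeticFunction.cardFactors (((f i).eval (n : ℤ)).toNat) ≤ k + 1).card : ℝ)) → ∀ ε : ℝ, 0 < ε → ∀ᶠ x : ℕ in Filter.atTop, (1 - ε) * (Literature.NumberTheory.Sieve.batemanHornConst f / (∏ i, ((f i).natDegree : ℝ)) * (x : ℝ) / Real.log x ^ k) ≤ (Literature.NumberTheory.Sieve.polyPrimeCount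 f x : ℝ)

-- parent: LowerNonlinear · glue (gen 1)
/--     item stmt-Parity-26568 · support · rank 304 · closed · proved by Summit.Parity.BatemanHorn.Theses.OneSidedDegreeLadder.lowerNonlinearGlue_holds (prover)
    parent: LowerNonlinear · GLUE: children ⟹ parent · by planner
ChenQuad → ChenRest → ParityLift → LowerNonlinear — kernel-proved in the cell file
HOME/decomp-parity-lens-1/g2/AlmostPrimeExcessLadder.lean (theorem closes, via chenGrade_iff +
almostPrimeCount_zero: the (1,1) grade on the quadratic cell and on the rest re-assemble LowerGrade
1 1, ParityLift lifts it cell-wise to polyPrimeCount); READY-TO-LAND, hand wanted -/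
@[route_item "route-Parity-OneSidedDegreeLadder"]
def LowerNonlinearGlue : Prop :=
  ChenQuad → ChenRest → ParityLift → LowerNonlinear

-- `LowerNonlinearGlue` holds: proved by `Summit.Parity.BatemanHorn.Theses.OneSidedDegreeLadder.lowerNonlinearGlue_holds` (its module imports this route file, so no `_holds` link can be stated here).

/-- item stmt-Parity-25178 · support · rank 9 · open · by planner
sources: BatemanHornMathComp1962, GreenTao2010
[support] [WEAKER: BH ⟹ it (`linearCell_of_batemanHorn`); COVERED-BY-SIBLING:
GeneralizedHardyLittlewood ⟹ LinearCell is the landed tree theorem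
`Summit.Parity.BatemanHorn.Theorems.SoloBlindLinearBH.generalizedHardyLittlewood_implies_linear_batemanHorn`
(statement verbatim); not staffed; leaf = the d = 1 content of the other conjunct (rungs
BoundedDickson stmt-Parity-13151, TwinLowerDensity stmt-Parity-18377; BARRIER PrimePairParity).
Tribunal residual (imported complement).] The Bateman–Horn asymptotic for every Bateman–Horn system
all of whose members have degree 1 (Dickson systems with no fixed prime divisor). [difficulty:
open-problem] -/
@[route_item "route-Parity-OneSidedDegreeLadder", crux]
def LinearCell : Prop :=
  ∀ (k : ℕ) (f : Fin k → Polynomial ℤ), Literature.NumberTheory.Sieve.IsBatemanHornSystem f → (∀ i, (f i).natDegree = 1) → Literature.NumberTheory.Sieve.BatemanHornAsymptotic f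

/-- item stmt-Parity-32819 · aside · rank 9 · open · by planner
[aside] consequence notch B1.1.4 «ChebyshevResultantSplit» beneath LowerNonlinear stmt-Parity-25177
(lens-2 g9 kernel HOME/decomp-parity-lens-2/g9/ChebyshevResultantSplit.lean §1 text verbatim with
ChebPos/ChebyshevAt inlined; critic CLEARED CRITIC-LEDGER row 88; writer DECISION
2026-08-30T11:51:32Z; registered by lens-1 g8 under the one-writer rule): NEVER STAFFED, ZERO
DISTANCE CREDIT, no prover time; decided instances enter as rungs BY NAME. SPECIAL CELL «binary
resultant»: Chebyshev's problem in its INFINITELY-OFTEN form (explicitly weaker than the printed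
«P(x; f) ≫ x^{1+δ} for all large x», which the rungs prove and cite as such) for every
one-polynomial Bateman–Horn system f of degree 2 or 3: for some δ > 0 there are infinitely many n
with f(n) ≠ 0 having a prime factor p > n^{1+δ}. NECESSARY (hyp-free kernel: LowerNonlinear ⟹
BunyakovskyNonlin ⟹ ChebAll ⟹ ChebBinary). WEAKER and T23-DIVIDING: a largest-prime-FACTOR
statement, independent of W_BH; all prime-VALUE content stays in the declared residual ChebLift =
ChebDescent ∧ BunyakovskyLift (theorems, not items; one floor, cite PowerThinning.LandauLift by
name). Decided instances by name: X²+1 face = tree rung family NsqPlu -/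
@[route_item "route-Parity-OneSidedDegreeLadder"]
def ChebBinary : Prop :=
  ∀ f : Polynomial ℤ, Literature.NumberTheory.Sieve.IsBatemanHornSystem ![f] → 2 ≤ f.natDegree → f.natDegree ≤ 3 → ∃ δ : ℝ, 0 < δ ∧ ∃ᶠ n : ℕ in Filter.atTop, f.eval (n : ℤ) ≠ 0 ∧ ∃ p : ℕ, p.Prime ∧ (p : ℤ) ∣ f.eval (n : ℤ) ∧ (n : ℝ) ^ (1 + δ) < p

/-- item stmt-Parity-32820 · aside · rank 9 · open · by planner
[aside] consequence notch B1.1.4 «ChebyshevResultantSplit» beneath LowerNonlinear stmt-Parity-25177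
(lens-2 g9 kernel HOME/decomp-parity-lens-2/g9/ChebyshevResultantSplit.lean §1 text verbatim with
ChebPos/ChebyshevAt inlined; critic CLEARED CRITIC-LEDGER row 88; writer DECISION
2026-08-30T11:51:32Z; registered by lens-1 g8 under the one-writer rule): NEVER STAFFED, ZERO
DISTANCE CREDIT, no prover time; decided instances enter as rungs BY NAME. GENERIC CELL
«ternary-or-higher resultant»: Chebyshev's problem in its INFINITELY-OFTEN form (explicitly weaker
than the printed «P(x; f) ≫ x^{1+δ} for all large x», which the rungs prove and cite as such) for
every one-polynomial Bateman–Horn system f of degree ≥ 4: for some δ > 0 there are infinitely many n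
with f(n) ≠ 0 having a prime factor p > n^{1+δ}. NECESSARY (hyp-free kernel: LowerNonlinear ⟹
BunyakovskyNonlin ⟹ ChebAll ⟹ ChebHigher). WEAKER and T23-DIVIDING: a largest-prime-FACTOR
statement, independent of W_BH; prime-VALUE content stays in the declared residual ChebLift
(theorems, not items). Decided sub-family in print: even V₄ quartics Φ₈ = X⁴+1, Φ₁₂ (Dartyge 2015),
X⁴−10X²+1 (de la Bretèche 2015 Thm 1.2); OPEN: X⁴+2, every non- -/
@[route_item "route-Parity-OneSidedDegreeLadder"]
def ChebHigher : Prop :=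
  ∀ f : Polynomial ℤ, Literature.NumberTheory.Sieve.IsBatemanHornSystem ![f] → 4 ≤ f.natDegree → ∃ δ : ℝ, 0 < δ ∧ ∃ᶠ n : ℕ in Filter.atTop, f.eval (n : ℤ) ≠ 0 ∧ ∃ p : ℕ, p.Prime ∧ (p : ℤ) ∣ f.eval (n : ℤ) ∧ (n : ℝ) ^ (1 + δ) < p

/-- item stmt-Parity-25179 · assembly · rank 1 · closed · proved by Summit.Parity.BatemanHorn.Theses.OneSidedDegreeLadder.assembly_proof (prover) · by planner
sources: BatemanHornMathComp1962
[assembly] LinearCell → UpperNonlinear → LowerNonlinear → BatemanHorn -/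
@[route_item "route-Parity-OneSidedDegreeLadder"]
def Assembly : Prop :=
  LinearCell → UpperNonlinear → LowerNonlinear → BatemanHorn

-- `Assembly` holds: proved by `Summit.Parity.BatemanHorn.Theses.OneSidedDegreeLadder.assembly_proof` (its module imports this route file, so no `_holds` link can be stated here).

/-! D-0027 §2.1 — DECIDING THEOREM (planner-authored via `route open/edit --closes-file`; by planner-decomp-parity-lens-1-g0-0 2026-08-30T02:24:47Z):
its hypotheses are this route's items and its conclusion the sub-problem Statement (glue_lint), and it elaborates with this file. -/

@[closes "route-Parity-OneSidedDegreeLadder"] theorem closes (hL : LinearCell) (hU : UpperNonlinear) (hLo : LowerNonlinear) : BatemanHorn := by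
  intro k f hf
  by_cases hex : ∃ i, 2 ≤ (f i).natDegree
  · have hbh := Literature.NumberTheory.Sieve.IsBatemanHornSystem.hasBatemanHornConst_holds hf
    refine ⟨Literature.NumberTheory.Sieve.batemanHornConst f, hbh.1, ?_⟩
    refine Asymptotics.isLittleO_iff.mpr fun c hc => ?_
    filter_upwards [hU k f hf hex c hc, hLo k f hf hex c hc] with x hux hlx
    simp only [Pi.sub_apply, Real.norm_eq_abs, Fintype.card_fin]
    have hC : 0 < Literature.NumberTheory.Sieve.batemanHornConst f := hbh.2
    have hD : 0 < ∏ i, ((f i).natDegree : ℝ) :=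
      Finset.prod_pos fun i _ => by exact_mod_cast hf.natDegree_pos i
    have hlog : 0 ≤ Real.log (x : ℝ) := Real.log_natCast_nonneg x
    have hv : 0 ≤ Literature.NumberTheory.Sieve.batemanHornConst f / (∏ i, ((f i).natDegree : ℝ))
        * (x : ℝ) / Real.log x ^ k := by positivity
    rw [abs_of_nonneg hv, abs_le]
    constructor <;> linarith
  · push Not at hex
    exact hL k f hf fun i => le_antisymm (Nat.lt_succ_iff.mp (hex i)) (hf.natDegree_pos i)

end Summit.Parity.BatemanHorn.Theses.OneSidedDegreeLadder
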